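import Literature.MathematicalPhysics.QuantumFieldTheory.Balaban1983to89.B12Plaquette343
import Literature.MathematicalPhysics.QuantumFieldTheory.Balaban1983to89.B12RegularSpaces111Mono

/-!
# `Balaban1983to89.B12Lemma4Concrete` — T. Bałaban, *Renormalization group approach to lattice gauge field theories. I*,
Commun. Math. Phys. **109** (1987) 249–301 [Balaban1987RG1]: **Lemma 4 (3.53) p. 280 / (3.36) p. 277 — the conditions
(i)–(iii) of the CONCRETE space `U^c_j(X, α₀, α₁)` of `B12RegularSpaces111` for the composite configuration
`exp iξ(𝐇_j(□₀, τQ(L⁻¹η𝐇_{k+1})) + 𝐀₂)`, ASSEMBLED from the printed bond-level inputs (3.37), (3.41), (3.45), (3.50)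
by the printed mechanism of pp. 277–280 — PART 1: the plaquette reading, the mechanism of (i)/(ii), the two half-budgets,
(iii) on the lattice** (PART 2 = the sibling `B12Lemma4Space`: the assembled Lemma 4 on `U^c_j(X, α₀, α₁)`), on the carriers of
record (nothing re-declared): the plaquette ladder of `B12Plaquette343` (first inequality of (iii), B′ = 0 and B′ ≠ 0), the
membership predicates `CondI`/`CondII`/`CondIII`/`SatisfiesI_III`/`Satisfies`/`space` of `B12RegularSpaces111`.

HONEST FRAMING (cell `lit-balaban`, verbatim): statement-level skeleton of published theorems with citation tags; proofs where landed; nothing here is a claim about the Yang–Mills mass gap.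

PDF held: `paper:balaban1987-cmp109-rg-i-small-field` (journal page = PDF page + 248); pp. 277–280 re-read as images from the
renders `b2b-balaban-ref1/pages/1987-cmp109-rg-I-small-field/1987-cmp109-rg-I-small-field-p029…p032-x2.png` by this unit.

THE PRINT, verbatim (pp. 277–280).  p. 277: *«We have to prove that (U_j(□₀, exp iτB), J_j(□₀, exp iτB))|_X ∈ U^c_j(X, α₀, α₁)
(3.36) for all 𝐔, 𝐉, 𝐀 in the above spaces, and for the parameters τ in the interval [0, 1].»* … *«U_j(□₀, exp iτQ(L⁻¹η𝐇_{k+1})) =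
(exp iξ𝐇_j(□₀, τQ(L⁻¹η𝐇_{k+1})))^{u_j}, |𝐇_j(□₀, τQ(…))|, |∇^ξ𝐇_j(□₀, τQ(…))| < B₃²O(1)Mα₀L^{j−1}η on □̃³, |u_j − 1| < B₃²O(1)Mα₀.
(3.37) Assume now that B₃²O(1)Mα₀ < 1/2α₁, then the orbit of the configuration U_j(□₀, …) above contains the configuration
exp iξ𝐇_j(…) satisfying the conditions (i), (ii) on the cube □̃³, hence on X. We will prove that this configuration satisfies all
the conditions (i)–(iv).»*  p. 278: *«This identity and the bound on u_j in (3.37) imply that the condition (iv) is a consequence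
of the condition (iii), with a bit better constant, for the pair of configurations exp iξ𝐇_j(…), D^{ξ*}_{exp iξ𝐇_j(…)}ξ⁻²π Im ∂
exp iξ𝐇_j(…).»*  p. 279: *«The above inequality is the required first inequality in the condition (iii). The second inequality in
this condition is obtained in the same way.»*  p. 279–280: *«We replace τQ′ by the variable B′ with values in 𝔤ᶜ, and we prove
(3.36) for B′ satisfying |B′| < α₃, with a sufficiently small constant α₃. To prove the conditions (i)–(iv) we write
𝐇_j(□₀, τQ(L⁻¹η𝐇_{k+1}) + B′) = 𝐇_j(□₀, τQ(L⁻¹η𝐇_{k+1})) + ∫₀¹dt₂⟨(δ/δB 𝐇_j)(□₀, τQ(L⁻¹η𝐇_{k+1}) + t₂B′), B′⟩ =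
𝐇_j(□₀, τQ(L⁻¹η𝐇_{k+1})) + 𝐀₂, (3.50) where the last equality is a definition of 𝐀₂. It implies |𝐀₂|, |∇^ξ𝐀₂| ≦ B₃|B′| <
B₃α₃, and if B₃α₃ < 1/2α₁, then this and the inequality in (3.37) imply the conditions (i), (ii).»* … *«|∂ exp iξ𝐇_j(□₀,
τQ(L⁻¹η𝐇_{k+1}) + B′) − 1| < (1+8β)L⁻²α₀ξ² on □̃³. (3.52) This implies the first inequality in the condition (iii). The second
is proved in the same way, as it was already discussed. The condition (iv) follows from the corresponding identity (3.38). Thus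
we have proved (3.36) in several versions. Let us formulate the one which will be used to bound the terms in (3.34).  **Lemma 4.**
For 𝐔 ∈ U′ᶜ_{k+1}(□₀, (1+2β)α₀, (1+2β)α₁), 𝐀 defined on □₀ and satisfying (3.31), B′ defined on the set of bonds connected with
the definition of U_j(□₀, ·) and satisfying |B′| < α₃, we have (U_j(□₀, exp i(τB + B′)), J_j(□₀, exp i(τB + B′)))|_X ∈
U^c_j(X, α₀, α₁) (3.53) for α₀, α₁, α₂, α₃ sufficiently small and satisfying all the restrictions.»*

THE READING (the one modelling decision, forced by the two printed half-budgets).  The factorisation `𝐔 = U′U` of conditions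
(i)/(ii) for the composite configuration `𝐔 = exp iξ𝐊`, `𝐊 := 𝐇_j(□₀, τQ(L⁻¹η𝐇_{k+1})) + 𝐀₂` (𝔤ᶜ-valued, p. 279 «B′ with
values in 𝔤ᶜ»), is the TRIVIAL one: `U = 1` (G-valued, `∂U = 1`, local gauge `u = 1`, `A = 0` in (1.12)) and `A′ = 𝐊`, so that
(ii) reads `|𝐊|, |∇^ξ𝐊| < α₁` (`∇^ξ_1 = ∇^ξ`, `B12RegularSpaces111.nabla_one`), which is exactly what the two printed
restrictions deliver: `|𝐇_j| + |𝐀₂| < B₃²O(1)Mα₀·L^{j−1}η + B₃α₃ < ½α₁ + ½α₁` («B₃²O(1)Mα₀ < 1/2α₁» p. 277, «B₃α₃ < 1/2α₁»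
p. 280, `L^{j−1}η ≤ L⁻¹ ≤ 1` p. 279 «j ≤ k, hence L^jη ≤ 1»).  The gauge transformation `u_j` of (3.37) only moves the pair
inside its orbit (`B12RegularSpaces111.act_mem_space_iff`), so membership is decided on `exp iξ𝐊` itself.

WHAT IS PROVED HERE, and nothing else.
(§1) THE PLAQUETTE READING IS THE PLAQUETTE VARIABLE: for every bond field `𝐊` and plaquette `p = (x, μ < ν)` of `Setup`,
`∂(exp iξ𝐊)(p) = B12RegularSpaces111.plaq (exp iξ𝐊) p = holonomy [iξ𝐊(x,μ), iξ𝐊(x+e_μ,ν), −iξ𝐊(x+e_ν,μ), −iξ𝐊(x,ν)]`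
(`plaq_expI_eq_holonomy`) — the ordered product of `B12Plaquette343` (there a modelling step, DIVERGENCE D-b12g15.1) IS the
plaquette variable of the spaces of record, so every plaquette theorem of that module applies to `CondIII.plaq_lt` verbatim.
(§2) THE MECHANISM OF (i)/(ii): `CondI` for `U = 1` is `B12RegularSpaces111Mono.condI_one` (reused, with its `expI_zero`,
`plaq_one`); here `Factors` with `U = 1`, `A′ = 𝐊`, `CondII` for `(1, 𝐊)` from `|𝐊|, |∇^ξ𝐊| < α₁`, hence `SatisfiesI_III` / `Satisfies` / membership in `space` for ANY pair
`(exp iξ𝐊, 𝐉)` with `𝐊` small in C¹ on `X`, `|∂ exp iξ𝐊 − 1| < α₀ξ²`, `|𝐉| < γ₀` (+ (iv) as data-level hypotheses)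
(`satisfiesI_III_expI`, `satisfies_expI`, `expI_mem_space`).
(§3) THE TWO HALF-BUDGETS: `|𝐇 + 𝐀₂| ≤ |𝐇| + |𝐀₂| < α₁` and the same for `∇^ξ` (linearity `grad_add`) from (3.37), (3.50) and the two
restrictions (`norm_add_lt_alpha1`, `norm_grad_add_lt_alpha1`).
(§4) (iii), FIRST INEQUALITY, ON THE LATTICE: `B12Plaquette343.condIII_first_plaquette_shifted` transported through §1 to the
plaquette variables of `exp iξ(𝐊 + 𝐀₂)` at one plaquette (`condIII_first_plaq`) and on a set of plaquettes whose bonds and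
derivative pairs lie in a region `Y` (= □̃³) carrying the bond data (`condIII_first_region`); inputs exactly those of that theorem:
the literal first inequality of (3.41), (3.37) at `Q(…)` and at `τQ(…)`, (3.45) at both against the linear part `ℓ(p)`, (3.50).
(§5, SIBLING FILE `B12Lemma4Space`) LEMMA 4 / (3.36) ON THE CONCRETE SPACE: under `B12Sec2to5.Lemma4Restrictions` + the three
unlisted constant hypotheses of `B12ExpSteps`, the pair `(exp iξ(𝐇_j(τQ) + 𝐀₂), 𝐉)` satisfies (i)–(iii) of `U^c_j(X, α₀, α₁)` and, given
(iv), lies in `space′` — assembled there from §2–§4 of this file (kept apart for the 400-line bound).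
NOT here (by-reference inputs, as in `B12Plaquette343`/`B12CondIIIJ`): the functions `𝐇_j`, `H_{1,j}`, `𝐀₂`, `u_j` of
[Balaban1985Variational] and their bounds (3.37)/(3.45)/(3.50) (hypotheses on bond data), the literal first inequality of (3.41)
(hypothesis), the current `𝐉 = D^{ξ*}ξ⁻²π Im ∂𝐔` itself (`B12Eq18Current.current`; here any `𝔤ᶜ`-valued bond field with its bound),
condition (iv) (hypothesis), analyticity («The functions in (3.53) are analytic», not modelled).  No `def`, no `Prop` placeholder, no
new fact; axioms standard.  Unit `lit-balaban-p07` (Phase-2 seat p07 gen 6; TAKING line HOME/STATUS.md 2026-08-21T06:32:00Z; rows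
B12.Lem4 / B12.Eq3.36, owners r09/r20), HOME `run/shared/lean/pub/lit-balaban/`.
-/

namespace Literature.MathematicalPhysics.QuantumFieldTheory.Balaban1983to89.B12Lemma4Concrete

open Literature.MathematicalPhysics.QuantumFieldTheory.Balaban1983to89
open Literature.MathematicalPhysics.QuantumFieldTheory.Balaban1983to89.Beta.TransportVertices
open Literature.MathematicalPhysics.QuantumFieldTheory.Balaban1983to89.B12RegularSpaces111
open Literature.MathematicalPhysics.QuantumFieldTheory.Balaban1983to89.B12RegularSpaces111Mono
open Complex (I)

noncomputable section

variable {P : Params} {i : ℕ} {𝔸 : Type*} [NormedRing 𝔸] [NormedAlgebra ℂ 𝔸] [CompleteSpace 𝔸]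

/-! ## §1. The plaquette reading of `B12Plaquette343` IS the plaquette variable of `B12RegularSpaces111` -/

/-- The bond variable `exp iξ𝐊(b)` has value `exp(iξ𝐊(b))`. [cite: Balaban1987RG1, (1.13) p.262] -/
theorem val_expI (ξ : ℝ) (a : 𝔸) : ((expI ξ a : 𝔸ˣ) : 𝔸) = NormedSpace.exp ((I * ξ) • a) := rfl

/-- On the reversed bond the variable is `exp(−iξ𝐊(b))` ([Balaban1985BackgroundPropagators] (3.5) «U(x, x′) = U⁻¹(x′, x)»).
[cite: Balaban1987RG1, (1.13) p.262] -/
theorem val_inv_expI (ξ : ℝ) (a : 𝔸) : (((expI ξ a)⁻¹ : 𝔸ˣ) : 𝔸) = NormedSpace.exp (-((I * ξ) • a)) := rfl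

/-- **The plaquette variable of `exp iξ𝐊` is the ordered product of `B12Plaquette343`.**  For `p = ⟨x, x+ξe_μ, x+ξe_μ+ξe_ν, x+ξe_ν⟩`
(`μ < ν`): `∂(exp iξ𝐊)(p) = e^{iξ𝐊(x,μ)}e^{iξ𝐊(x+e_μ,ν)}e^{−iξ𝐊(x+e_ν,μ)}e^{−iξ𝐊(x,ν)}` — the plaquette variable (1.11)/(1.14) of the
spaces of record (`B12RegularSpaces111.plaq`) equals the `holonomy` of the four oriented exponents (the reading D-b12g15.1 of
`B12Plaquette343`, now an identity on the carriers). [cite: Balaban1987RG1, (1.14) p.262] -/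
theorem plaq_expI_eq_holonomy (ξ : ℝ) (K : PBond P i → 𝔸) (p : Plaq P i) :
    ((plaq (fun b => expI ξ (K b)) p : 𝔸ˣ) : 𝔸) =
      holonomy [(I * ξ) • K ⟨p.src, p.μ⟩, (I * ξ) • K ⟨p.src.shift p.μ, p.ν⟩,
        -((I * ξ) • K ⟨p.src.shift p.ν, p.μ⟩), -((I * ξ) • K ⟨p.src, p.ν⟩)] := by
  rw [plaq_eq]
  simp only [Units.val_mul, val_expI, val_inv_expI, holonomy_cons, holonomy_nil, mul_one, mul_assoc]

/-! ## §2. The mechanism of (i)/(ii): the trivial `G`-factor `U = 1`, `A′ = 𝐊` -/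

section Mechanism

variable (𝓜 : Model 𝔸)

/-- **The trivial factorisation** `exp iξ𝐊 = (exp iξ𝐊)·1` («𝐔 = U′U», «U′ = exp iξA′» with `U = 1`, `A′ = 𝐊`).
[cite: Balaban1987RG1, (1.11) p.262] -/
theorem factors_expI_one (c : StepConsts) (K : PBond P i → 𝔸) : Factors c (fun b => expI c.ξ (K b)) 1 K := by
  intro b
  simp only [Pi.one_apply, mul_one]

omit [CompleteSpace 𝔸] in
/-- **Condition (ii) for `(U, A′) = (1, 𝐊)`** («A′ has values in the algebra 𝔤ᶜ, |A′|, |∇^ξ_U A′| < α₁ on X. (1.13)»; `∇^ξ_1 = ∇^ξ`):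
from `𝐊` `𝔤ᶜ`-valued with `|𝐊|, |∇^ξ𝐊| < α₁` on `X` — the form in which p. 277 «B₃²O(1)Mα₀ < 1/2α₁» and p. 280 «B₃α₃ < 1/2α₁ … imply
the conditions (i), (ii)» use it. [cite: Balaban1987RG1, (1.13) p.262] -/
theorem condII_one {X : Region P i} {c : StepConsts} {α₁ : ℝ} {K : PBond P i → 𝔸} (hKgc : ∀ b ∈ X.bonds, K b ∈ 𝓜.gc)
    (hK0 : ∀ b ∈ X.bonds, ‖K b‖ < α₁) (hK1 : ∀ q ∈ X.dpairs, ‖grad c.ξ q.2.1 (fun y => K ⟨y, q.2.2⟩) q.1‖ < α₁) :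
    CondII 𝓜 X c α₁ (1 : PBond P i → 𝔸ˣ) K := by
  refine ⟨hKgc, hK0, fun q hq => ?_⟩
  rw [nabla_one]
  exact hK1 q hq

/-- **(i)–(iii) for a pair `(exp iξ𝐊, 𝐉)`** — the mechanism of pp. 277/280 («the configuration exp iξ𝐇_j(…) satisfying the
conditions (i), (ii) …»): if `𝐊` is `𝔤ᶜ`-valued with `|𝐊|, |∇^ξ𝐊| < α₁` on `X`, `exp iξ·` maps `𝔤ᶜ` into `Gᶜ`, `|∂ exp iξ𝐊 − 1| < α₀ξ²`
and `𝐉` is `𝔤ᶜ`-valued with `|𝐉| < γ₀` on `X` (`α₀, ξ, O(1)LMB > 0`), then `(exp iξ𝐊, 𝐉)` satisfy (i)–(iii) with `(α₀, α₁, γ₀)`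
(witnesses `U = 1`, `A′ = 𝐊`). [cite: Balaban1987RG1, (3.36) p.277] -/
theorem satisfiesI_III_expI {F : Frame P i 𝔸} {c : StepConsts} (hξ : 0 < c.ξ) (hcB : 0 < c.cB) {α₀ α₁ γ₀ : ℝ}
    (hα₀ : 0 < α₀) (heGc : ∀ A ∈ 𝓜.gc, expI c.ξ A ∈ 𝓜.Gc) {K J : PBond P i → 𝔸}
    (hKgc : ∀ b ∈ F.X.bonds, K b ∈ 𝓜.gc) (hJgc : ∀ b ∈ F.X.bonds, J b ∈ 𝓜.gc) (hK0 : ∀ b ∈ F.X.bonds, ‖K b‖ < α₁)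
    (hK1 : ∀ q ∈ F.X.dpairs, ‖grad c.ξ q.2.1 (fun y => K ⟨y, q.2.2⟩) q.1‖ < α₁)
    (hplaq : ∀ p ∈ F.X.plaqs, ‖((plaq (fun b => expI c.ξ (K b)) p : 𝔸ˣ) : 𝔸) - 1‖ < α₀ * c.ξ ^ 2)
    (hJ : ∀ b ∈ F.X.bonds, ‖J b‖ < γ₀) :
    SatisfiesI_III 𝓜 F c α₀ α₁ γ₀ ⟨fun b => expI c.ξ (K b), J⟩ :=
  ⟨fun b hb => heGc _ (hKgc b hb), hJgc, 1, K, factors_expI_one c K, condI_one F hξ.ne' hcB hα₀, condII_one 𝓜 hKgc hK0 hK1,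
    ⟨hplaq, hJ⟩⟩

/-- **(i)–(iv) for a pair `(exp iξ𝐊, 𝐉)`**: as `satisfiesI_III_expI`, plus condition (iv) (1.16) for `𝐔 = exp iξ𝐊` and for the factor
`U = 1` as hypotheses («The condition (iv) follows from the corresponding identity (3.38)» — the functions `U_n(M˙(·))`, `J_n(M˙(·))`
of (1.15) are data). [cite: Balaban1987RG1, (1.11)-(1.16) p.262] -/
theorem satisfies_expI {F : Frame P i 𝔸} {c : StepConsts} (hξ : 0 < c.ξ) (hcB : 0 < c.cB) {α₀ α₁ γ₀ : ℝ}
    (hα₀ : 0 < α₀) (heGc : ∀ A ∈ 𝓜.gc, expI c.ξ A ∈ 𝓜.Gc) {K J : PBond P i → 𝔸}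
    (hKgc : ∀ b ∈ F.X.bonds, K b ∈ 𝓜.gc) (hJgc : ∀ b ∈ F.X.bonds, J b ∈ 𝓜.gc) (hK0 : ∀ b ∈ F.X.bonds, ‖K b‖ < α₁)
    (hK1 : ∀ q ∈ F.X.dpairs, ‖grad c.ξ q.2.1 (fun y => K ⟨y, q.2.2⟩) q.1‖ < α₁)
    (hplaq : ∀ p ∈ F.X.plaqs, ‖((plaq (fun b => expI c.ξ (K b)) p : 𝔸ˣ) : 𝔸) - 1‖ < α₀ * c.ξ ^ 2)
    (hJ : ∀ b ∈ F.X.bonds, ‖J b‖ < γ₀) (hIV : CondIV F.bg F.X₂ c α₀ (fun b => expI c.ξ (K b)))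
    (hIV₁ : CondIV F.bg F.X₂ c α₀ (1 : PBond P i → 𝔸ˣ)) :
    Satisfies 𝓜 F c α₀ α₁ γ₀ ⟨fun b => expI c.ξ (K b), J⟩ :=
  ⟨fun b hb => heGc _ (hKgc b hb), hJgc, 1, K, factors_expI_one c K, condI_one F hξ.ne' hcB hα₀, condII_one 𝓜 hKgc hK0 hK1,
    ⟨hplaq, hJ⟩, hIV, hIV₁⟩

/-- **Membership**: under the hypotheses of `satisfies_expI`, `(exp iξ𝐊, 𝐉) ∈ U^c_j(X, α₀, α₁, γ₀)` (its own orbit).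
[cite: Balaban1987RG1, (3.36) p.277] -/
theorem expI_mem_space {F : Frame P i 𝔸} {c : StepConsts} (hξ : 0 < c.ξ) (hcB : 0 < c.cB) {α₀ α₁ γ₀ : ℝ}
    (hα₀ : 0 < α₀) (heGc : ∀ A ∈ 𝓜.gc, expI c.ξ A ∈ 𝓜.Gc) {K J : PBond P i → 𝔸}
    (hKgc : ∀ b ∈ F.X.bonds, K b ∈ 𝓜.gc) (hJgc : ∀ b ∈ F.X.bonds, J b ∈ 𝓜.gc) (hK0 : ∀ b ∈ F.X.bonds, ‖K b‖ < α₁)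
    (hK1 : ∀ q ∈ F.X.dpairs, ‖grad c.ξ q.2.1 (fun y => K ⟨y, q.2.2⟩) q.1‖ < α₁)
    (hplaq : ∀ p ∈ F.X.plaqs, ‖((plaq (fun b => expI c.ξ (K b)) p : 𝔸ˣ) : 𝔸) - 1‖ < α₀ * c.ξ ^ 2)
    (hJ : ∀ b ∈ F.X.bonds, ‖J b‖ < γ₀) (hIV : CondIV F.bg F.X₂ c α₀ (fun b => expI c.ξ (K b)))
    (hIV₁ : CondIV F.bg F.X₂ c α₀ (1 : PBond P i → 𝔸ˣ)) :
    (⟨fun b => expI c.ξ (K b), J⟩ : FieldPair P i 𝔸ˣ 𝔸) ∈ space 𝓜 F c α₀ α₁ γ₀ :=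
  mem_space_of_satisfies (satisfies_expI 𝓜 hξ hcB hα₀ heGc hKgc hJgc hK0 hK1 hplaq hJ hIV hIV₁)

end Mechanism

/-! ## §3. The two half-budgets of (ii): (3.37) «B₃²O(1)Mα₀ < 1/2α₁» and (3.50) «B₃α₃ < 1/2α₁» -/

/-- The arithmetic of the two halves: `n_H < Y·x ≤ Y < ½α₁` (`x ≤ 1`, `Y = B₃²O(1)Mα₀ ≥ 0`) and `n_A ≤ B₃n ≤ B₃α₃ < ½α₁`
(`n = |B′| < α₃`, `B₃ ≥ 0`) give `n_H + n_A < α₁`. [folklore] -/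
private theorem half_budgets {Y B₃ α₁ α₃ x n nH nA : ℝ} (hx1 : x ≤ 1) (hY : 0 ≤ Y) (hB : 0 ≤ B₃)
    (hres9 : Y < α₁ / 2) (hres12 : B₃ * α₃ < α₁ / 2) (hH : nH < Y * x) (hn : n < α₃) (hA : nA ≤ B₃ * n) :
    nH + nA < α₁ := by
  have h1 : Y * x ≤ Y := by nlinarith
  have h2 : B₃ * n ≤ B₃ * α₃ := mul_le_mul_of_nonneg_left hn.le hB
  linarith

omit [NormedAlgebra ℂ 𝔸] [CompleteSpace 𝔸] in
/-- **`|𝐇_j + 𝐀₂| < α₁`** at a bond: from (3.37) `|𝐇_j| < B₃²O(1)Mα₀·x` (`x = L^{j−1}η ∈ [0, 1]`), (3.50) `|𝐀₂| ≤ B₃|B′|`, `|B′| < α₃`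
and the two restrictions «B₃²O(1)Mα₀ < 1/2α₁» (p. 277), «B₃α₃ < 1/2α₁» (p. 280) — the first clause of (ii) for `A′ = 𝐇_j + 𝐀₂`.
[cite: Balaban1987RG1, (3.37) p.277 with (3.50) p.280] -/
theorem norm_add_lt_alpha1 {B₃ O₁ M α₀ α₁ α₃ x n : ℝ} {H A : 𝔸} (hx1 : x ≤ 1) (hB : 0 ≤ B₃)
    (hY : 0 ≤ B₃ ^ 2 * O₁ * M * α₀) (hres9 : B₃ ^ 2 * O₁ * M * α₀ < α₁ / 2) (hres12 : B₃ * α₃ < α₁ / 2)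
    (hH : ‖H‖ < B₃ ^ 2 * O₁ * M * α₀ * x) (hn : n < α₃) (hA : ‖A‖ ≤ B₃ * n) : ‖H + A‖ < α₁ :=
  (norm_add_le H A).trans_lt (half_budgets hx1 hY hB hres9 hres12 hH hn hA)

omit [NormedRing 𝔸] [NormedAlgebra ℂ 𝔸] [CompleteSpace 𝔸] in
/-- `∇^ξ` is additive: `∇^ξ_μ(f + g) = ∇^ξ_μ f + ∇^ξ_μ g`. [folklore] -/
private theorem grad_add' [NormedRing 𝔸] [NormedAlgebra ℂ 𝔸] (ξ : ℝ) (μ : Fin P.d) (f g : Site P i → 𝔸) (x : Site P i) :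
    grad ξ μ (fun y => f y + g y) x = grad ξ μ f x + grad ξ μ g x := by
  simp only [grad, ← smul_add]
  congr 1
  abel

omit [CompleteSpace 𝔸] in
/-- `∇^ξ(𝐇 + 𝐀₂) = ∇^ξ𝐇 + ∇^ξ𝐀₂` («|∇^ξ𝐀₂| ≦ B₃|B′|» enters (ii) through this linearity). [cite: Balaban1987RG1, (3.50) p.280] -/
theorem grad_add (ξ : ℝ) (μ : Fin P.d) (f g : Site P i → 𝔸) (x : Site P i) :
    grad ξ μ (fun y => f y + g y) x = grad ξ μ f x + grad ξ μ g x :=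
  grad_add' ξ μ f g x

omit [CompleteSpace 𝔸] in
/-- **`|∇^ξ(𝐇_j + 𝐀₂)| < α₁`** at a derivative pair: from (3.37) `|∇^ξ𝐇_j| < B₃²O(1)Mα₀·x`, (3.50) `|∇^ξ𝐀₂| ≤ B₃|B′|`, `|B′| < α₃` and
the two restrictions — the second clause of (ii) for `A′ = 𝐇_j + 𝐀₂` (with `∇^ξ_U = ∇^ξ` at `U = 1`).
[cite: Balaban1987RG1, (3.37) p.277 with (3.50) p.280] -/
theorem norm_grad_add_lt_alpha1 {B₃ O₁ M α₀ α₁ α₃ x n : ℝ} (ξ : ℝ) (μ : Fin P.d) {f g : Site P i → 𝔸} (y : Site P i)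
    (hx1 : x ≤ 1) (hB : 0 ≤ B₃) (hY : 0 ≤ B₃ ^ 2 * O₁ * M * α₀) (hres9 : B₃ ^ 2 * O₁ * M * α₀ < α₁ / 2)
    (hres12 : B₃ * α₃ < α₁ / 2) (hH : ‖grad ξ μ f y‖ < B₃ ^ 2 * O₁ * M * α₀ * x) (hn : n < α₃)
    (hA : ‖grad ξ μ g y‖ ≤ B₃ * n) : ‖grad ξ μ (fun z => f z + g z) y‖ < α₁ := by
  rw [grad_add]
  exact (norm_add_le _ _).trans_lt (half_budgets hx1 hY hB hres9 hres12 hH hn hA)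

/-! ## §4. Condition (iii), first inequality, for `exp iξ(𝐇_j(τQ) + 𝐀₂)` on the lattice -/

/-- **(iii), first inequality, at one plaquette of the lattice** — `B12Plaquette343.condIII_first_plaquette_shifted` read through
`plaq_expI_eq_holonomy`: for `p = (x, μ < ν)` with bonds `b₁ = (x,μ)`, `b₂ = (x+e_μ,ν)`, `b₃ = (x+e_ν,μ)`, `b₄ = (x,ν)`, bond data
`𝐇 = 𝐇_j(□₀, Q(…))`, `𝐊 = 𝐇_j(□₀, τQ(…))`, `𝐀 = 𝐀₂`, linear part `ℓ = (∂^ξH_{1,j}Q(…))(p)`: the literal first inequality of (3.41) for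
`∂(exp iξ𝐇)(p)`, (3.37) for `𝐇` and `𝐊` at the four bonds, (3.45) at `Q` and at `τQ`, (3.50) `|𝐀₂(b_i)| ≤ B₃|B′|`,
`|∇^ξ_μ(𝐀₂)_ν(x)|, |∇^ξ_ν(𝐀₂)_μ(x)| ≤ B₃|B′|`, `|B′| < α₃`, `Lemma4Restrictions` + the three unlisted constant hypotheses ⇒
`|∂(exp iξ(𝐊 + 𝐀))(p) − 1| < α₀ξ²` — «This implies the first inequality in the condition (iii)».
[cite: Balaban1987RG1, (3.52) p.280 with (1.14)(iii) p.262] -/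
theorem condIII_first_plaq (c : B12Sec2to5.Lemma4Consts) (hR : B12Sec2to5.Lemma4Restrictions c)
    (hB : 1 ≤ c.B₃) (hY : 1 ≤ c.B₃ ^ 2 * c.O₁ * c.M) (hα₁ : 16 * (c.O₁ * c.M * c.α₁) ≤ c.β)
    {η ξ τ n : ℝ} {j : ℕ} (hη : 0 ≤ η) (hj : 1 ≤ j) (hscale : c.L ^ j * η ≤ 1)
    (hξ : 0 < ξ) (hξ1 : ξ ≤ 1) (hξx : ξ * (c.L ^ (j - 1) * η) = c.L⁻¹ * η) (hτ0 : 0 ≤ τ) (hτ1 : τ ≤ 1) (hn : n < c.α₃)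
    {H K A : PBond P i → 𝔸} (p : Plaq P i) {ℓ : 𝔸}
    (h41 : ‖((plaq (fun b => expI ξ (H b)) p : 𝔸ˣ) : 𝔸) - 1‖ <
      Real.exp (c.B₃ ^ 2 * c.O₁ * c.M * c.α₀) * Real.exp (c.B₃ * c.O₁ * c.M * c.α₀) *
      Real.exp (c.B₃ * c.O₁ * c.M * c.α₀) * Real.exp (c.O₁ * c.M * c.α₁) *
      ((1 + 2 * c.β) * c.α₀ * (c.L⁻¹ * η) ^ 2))
    (hH₁ : ‖H ⟨p.src, p.μ⟩‖ < c.B₃ ^ 2 * c.O₁ * c.M * c.α₀ * (c.L ^ (j - 1) * η))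
    (hH₂ : ‖H ⟨p.src.shift p.μ, p.ν⟩‖ < c.B₃ ^ 2 * c.O₁ * c.M * c.α₀ * (c.L ^ (j - 1) * η))
    (hH₃ : ‖H ⟨p.src.shift p.ν, p.μ⟩‖ < c.B₃ ^ 2 * c.O₁ * c.M * c.α₀ * (c.L ^ (j - 1) * η))
    (hH₄ : ‖H ⟨p.src, p.ν⟩‖ < c.B₃ ^ 2 * c.O₁ * c.M * c.α₀ * (c.L ^ (j - 1) * η))
    (h45 : ‖(ξ : ℂ)⁻¹ • (H ⟨p.src, p.μ⟩ + H ⟨p.src.shift p.μ, p.ν⟩ - H ⟨p.src.shift p.ν, p.μ⟩ - H ⟨p.src, p.ν⟩) - ℓ‖ <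
      c.B₃ * (c.B₃ * c.O₁ * c.M * c.α₀ * (c.L ^ (j - 1) * η)) ^ 2)
    (hK₁ : ‖K ⟨p.src, p.μ⟩‖ < c.B₃ ^ 2 * c.O₁ * c.M * c.α₀ * (c.L ^ (j - 1) * η))
    (hK₂ : ‖K ⟨p.src.shift p.μ, p.ν⟩‖ < c.B₃ ^ 2 * c.O₁ * c.M * c.α₀ * (c.L ^ (j - 1) * η))
    (hK₃ : ‖K ⟨p.src.shift p.ν, p.μ⟩‖ < c.B₃ ^ 2 * c.O₁ * c.M * c.α₀ * (c.L ^ (j - 1) * η))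
    (hK₄ : ‖K ⟨p.src, p.ν⟩‖ < c.B₃ ^ 2 * c.O₁ * c.M * c.α₀ * (c.L ^ (j - 1) * η))
    (h45τ : ‖(ξ : ℂ)⁻¹ • (K ⟨p.src, p.μ⟩ + K ⟨p.src.shift p.μ, p.ν⟩ - K ⟨p.src.shift p.ν, p.μ⟩ - K ⟨p.src, p.ν⟩) -
      (τ : ℂ) • ℓ‖ < c.B₃ * (c.B₃ * c.O₁ * c.M * c.α₀ * (c.L ^ (j - 1) * η)) ^ 2)
    (hA₁ : ‖A ⟨p.src, p.μ⟩‖ ≤ c.B₃ * n) (hA₂ : ‖A ⟨p.src.shift p.μ, p.ν⟩‖ ≤ c.B₃ * n)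
    (hA₃ : ‖A ⟨p.src.shift p.ν, p.μ⟩‖ ≤ c.B₃ * n) (hA₄ : ‖A ⟨p.src, p.ν⟩‖ ≤ c.B₃ * n)
    (hdμ : ‖grad ξ p.μ (fun y => A ⟨y, p.ν⟩) p.src‖ ≤ c.B₃ * n) (hdν : ‖grad ξ p.ν (fun y => A ⟨y, p.μ⟩) p.src‖ ≤ c.B₃ * n) :
    ‖((plaq (fun b => expI ξ (K b + A b)) p : 𝔸ˣ) : 𝔸) - 1‖ < c.α₀ * ξ ^ 2 := by
  rw [plaq_expI_eq_holonomy] at h41 ⊢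
  exact B12Plaquette343.condIII_first_plaquette_shifted c hR hB hY hα₁ hη hj hscale hξ hξ1 hξx hτ0 hτ1 h41 hH₁ hH₂ hH₃ hH₄
    h45 hK₁ hK₂ hK₃ hK₄ h45τ hn hA₁ hA₂ hA₃ hA₄ hdμ hdν

/-- **(iii), first inequality, on a set of plaquettes `Xp` (= the plaquettes of `X`) whose bonds and derivative pairs lie in a region `Y`
(= □̃³ ⊇ X)**: with the bond data of (3.37) (at `Q` and `τQ`) and (3.50) given on `Y.bonds`/`Y.dpairs` and the plaquette data (3.41),
(3.45) (at `Q`, `τQ`) given on `Xp`, every `p ∈ Xp` has `|∂(exp iξ(𝐊 + 𝐀₂))(p) − 1| < α₀ξ²`.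
[cite: Balaban1987RG1, (3.52) p.280 with (1.14)(iii) p.262] -/
theorem condIII_first_region (c : B12Sec2to5.Lemma4Consts) (hR : B12Sec2to5.Lemma4Restrictions c)
    (hB : 1 ≤ c.B₃) (hY : 1 ≤ c.B₃ ^ 2 * c.O₁ * c.M) (hα₁ : 16 * (c.O₁ * c.M * c.α₁) ≤ c.β)
    {η ξ τ n : ℝ} {j : ℕ} (hη : 0 ≤ η) (hj : 1 ≤ j) (hscale : c.L ^ j * η ≤ 1)
    (hξ : 0 < ξ) (hξ1 : ξ ≤ 1) (hξx : ξ * (c.L ^ (j - 1) * η) = c.L⁻¹ * η) (hτ0 : 0 ≤ τ) (hτ1 : τ ≤ 1) (hn : n < c.α₃)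
    {Xp : Set (Plaq P i)} {Y : Region P i}
    (hXY : ∀ p ∈ Xp, (⟨p.src, p.μ⟩ : PBond P i) ∈ Y.bonds ∧ (⟨p.src.shift p.μ, p.ν⟩ : PBond P i) ∈ Y.bonds ∧
      (⟨p.src.shift p.ν, p.μ⟩ : PBond P i) ∈ Y.bonds ∧ (⟨p.src, p.ν⟩ : PBond P i) ∈ Y.bonds ∧
      (p.src, p.μ, p.ν) ∈ Y.dpairs ∧ (p.src, p.ν, p.μ) ∈ Y.dpairs)
    {H K A : PBond P i → 𝔸} {ℓ : Plaq P i → 𝔸}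
    (h41 : ∀ p ∈ Xp, ‖((plaq (fun b => expI ξ (H b)) p : 𝔸ˣ) : 𝔸) - 1‖ <
      Real.exp (c.B₃ ^ 2 * c.O₁ * c.M * c.α₀) * Real.exp (c.B₃ * c.O₁ * c.M * c.α₀) *
      Real.exp (c.B₃ * c.O₁ * c.M * c.α₀) * Real.exp (c.O₁ * c.M * c.α₁) *
      ((1 + 2 * c.β) * c.α₀ * (c.L⁻¹ * η) ^ 2))
    (hH : ∀ b ∈ Y.bonds, ‖H b‖ < c.B₃ ^ 2 * c.O₁ * c.M * c.α₀ * (c.L ^ (j - 1) * η))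
    (h45 : ∀ p ∈ Xp, ‖(ξ : ℂ)⁻¹ • (H ⟨p.src, p.μ⟩ + H ⟨p.src.shift p.μ, p.ν⟩ - H ⟨p.src.shift p.ν, p.μ⟩ - H ⟨p.src, p.ν⟩) -
      ℓ p‖ < c.B₃ * (c.B₃ * c.O₁ * c.M * c.α₀ * (c.L ^ (j - 1) * η)) ^ 2)
    (hK : ∀ b ∈ Y.bonds, ‖K b‖ < c.B₃ ^ 2 * c.O₁ * c.M * c.α₀ * (c.L ^ (j - 1) * η))
    (h45τ : ∀ p ∈ Xp, ‖(ξ : ℂ)⁻¹ • (K ⟨p.src, p.μ⟩ + K ⟨p.src.shift p.μ, p.ν⟩ - K ⟨p.src.shift p.ν, p.μ⟩ - K ⟨p.src, p.ν⟩) -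
      (τ : ℂ) • ℓ p‖ < c.B₃ * (c.B₃ * c.O₁ * c.M * c.α₀ * (c.L ^ (j - 1) * η)) ^ 2)
    (hA : ∀ b ∈ Y.bonds, ‖A b‖ ≤ c.B₃ * n)
    (hdA : ∀ q ∈ Y.dpairs, ‖grad ξ q.2.1 (fun y => A ⟨y, q.2.2⟩) q.1‖ ≤ c.B₃ * n) :
    ∀ p ∈ Xp, ‖((plaq (fun b => expI ξ (K b + A b)) p : 𝔸ˣ) : 𝔸) - 1‖ < c.α₀ * ξ ^ 2 := by
  intro p hp
  obtain ⟨hb₁, hb₂, hb₃, hb₄, hd₁, hd₂⟩ := hXY p hp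
  exact condIII_first_plaq c hR hB hY hα₁ hη hj hscale hξ hξ1 hξx hτ0 hτ1 hn p (h41 p hp) (hH _ hb₁) (hH _ hb₂) (hH _ hb₃)
    (hH _ hb₄) (h45 p hp) (hK _ hb₁) (hK _ hb₂) (hK _ hb₃) (hK _ hb₄) (h45τ p hp) (hA _ hb₁) (hA _ hb₂) (hA _ hb₃) (hA _ hb₄)
    (hdA _ hd₁) (hdA _ hd₂)

end

end Literature.MathematicalPhysics.QuantumFieldTheory.Balaban1983to89.B12Lemma4Concrete
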